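import Literature.IUT.HodgeArakelov.GaloisPairCyclotomesGenuineRigidityNatural
import Literature.AnabelianGeometry.AbsoluteAnabelian.AbsAnabUnitsTransportIntegers
import Literature.AnabelianGeometry.AbsoluteAnabelian.AbsAnabUnitsTransportHolds

/-!
# NV-L6/GalRigidityInput at the genuine `AbsTopMonoids`: half (b2) DISCHARGED — the row modulo (b1) alone,
# (b1) = naturality of the torsion identification `μ_{ℚ/ℤ}(G_k) ⥲ (k̄ˣ)_tors` under units transports

Mochizuki, *Inter-universal Teichmüller theory II*, §1, Cor. 1.11 (a), kurims manuscript (Dec. 2020) p. 49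
ll. 9–21 [claim: Mochizuki2012, status: disputed] (IUTchII §1 Cor 1.11, kurims p.49); Mochizuki, *Topics in absolute
anabelian geometry III*, Rmk. 3.2.1 p. 73, Prop. 3.2 (iv) p. 72 [cite: MochizukiAbsTopIII2015, Remark 3.2.1 p.73];
Mochizuki, *The absolute anabelian geometry of hyperbolic curves* (2004), Prop. 1.2.1 (vi)(vii) pp. 10–11
[cite: MochizukiAbsAnab2004, Prop 1.2.1 (vii) p.11].

abc-iut cell, layer L6; seat abc-iut-w4-d030 (gen 2); third file of the NV-L6/GalRigidityInput assembly
(`GaloisPairCyclotomesGenuineRigidity` p421900: the row modulo `hnat` (b); `…Natural` p423689: (b) = (b1) + (b2)).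
Half **(b2)** «a units transport `ψ̄_φ : k̄ˣ ⥲ k̄ˣ` along `φ` ([AbsAnab] Prop. 1.2.1 (vii): `φ`-equivariant, preserving
absolute units and uniformisers) restricts on `𝒪_k̄^⊳` to THE lift `liftM φ` of [AbsTopIII] Prop. 3.2 (iv)» is
abc-iut-L6-t13's `Prop121vii.liftM_coe_eq_of_unitsTransport` (`AbsAnabUnitsTransportIntegers`, p423636 ✓), and such a
`ψ̄_φ` EXISTS for every `φ` by abc-iut-L4-d3's `Prop121vii.unitsTransport_holds` (p418393 ✓) and is unique
(`unitsTransport_unique`, p417701 ✓). THIS FILE (proof-only) consumes them BY NAME: `coe_unitsTransport_unitsMap_eq_liftM`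
(hβ of `hnat_of_unitsTransport` for every such `ψ̄_φ`), and the row in its two remaining honest forms —
`nonempty_galRigidityInput_genuineOfModel_of_exists_muLift_natural` (for each `φ` SOME units transport intertwined with
`μ_{ℚ/ℤ}(φ)` by `D.muLift`, the shape of abc-iut-L6-t11's «RMK321-NAT» (N2)/(N4)) and
`nonempty_galRigidityInput_genuineOfModel_of_muLift_natural` (`D.muLift` natural for EVERY units transport; the witness
`ψ̄_φ` supplied here by `unitsTransport_holds`). What remains — (b1), OWNER abc-iut-L6-t11 g6 (L4-lead ruling #4f) — is
the classical statement that the direct limit of the `Art_{L_U}⁻¹|_tors` is compatible with `Art_{φU} ∘ ψ̄ = φ^ab ∘ Art_U`.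
HONEST LIMITS: (b1) is an inline hypothesis (no `def … : Prop`); nothing of [IUTchII] is asserted; no side is taken on
[IUTchIII] Cor. 3.12. Proof-only, no definitions.
-/

noncomputable section

namespace Literature.IUT.HodgeArakelov

open CategoryTheory Literature.AnabelianGeometry.AbsoluteAnabelian
open Literature.AnabelianGeometry.EtaleTheta (cyclotome)

namespace AbsTopMonoids.Genuine

variable (k : Type) [Field k] [CharZero k] [ValuativeRel k] [TopologicalSpace k] [IsNonarchimedeanLocalField k]

/-- **(b2) discharged.** For a `φ`-equivariant units transport `ψ : k̄ˣ ⥲ k̄ˣ` preserving absolute units and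
uniformisers, `ψ` agrees on the units of `𝒪_k̄^⊳` with THE lift `liftM φ` (abc-iut-L6-t13's
`Prop121vii.liftM_coe_eq_of_unitsTransport`, read on `Units.map 𝒪^⊳.subtype u = Units.mk0 ↑u _`).
[cite: MochizukiAbsTopIII2015, Proposition 3.2 (iv) p.72] -/
theorem coe_unitsTransport_unitsMap_eq_liftM
    {φ : haveI := compactSpace_stdGalois k
      (ModelMLFGaloisData.galois (MLFClosure.std k).k (MLFClosure.std k).K).tmPair.Pi ≃ₜ*
        (ModelMLFGaloisData.galois (MLFClosure.std k).k (MLFClosure.std k).K).tmPair.Pi}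
    {ψ : (AlgebraicClosure k)ˣ ≃* (AlgebraicClosure k)ˣ} (hψ : Prop121vii.IsAlphaEquivariant (K₁ := k) (K₂ := k) φ ψ)
    (hU : Prop121vii.PreservesAbsUnits ψ) (hπ : Prop121vii.PreservesUniformizers ψ)
    (u : (nonzeroIntegers k (AlgebraicClosure k))ˣ) :
    (ψ.toMonoidHom (Units.map ((nonzeroIntegers k (AlgebraicClosure k)).subtype :
        nonzeroIntegers k (AlgebraicClosure k) →* AlgebraicClosure k) u) : AlgebraicClosure k) =
      (Subtype.val (liftM (MLFClosure.std k) φ (u : nonzeroIntegers k (AlgebraicClosure k))) :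
        AlgebraicClosure k) := by
  have hmk : Units.map ((nonzeroIntegers k (AlgebraicClosure k)).subtype :
      nonzeroIntegers k (AlgebraicClosure k) →* AlgebraicClosure k) u =
      Units.mk0 (((u : nonzeroIntegers k (AlgebraicClosure k))) : AlgebraicClosure k)
        (u : nonzeroIntegers k (AlgebraicClosure k)).2.2 :=
    Units.ext rfl
  rw [MulEquiv.coe_toMonoidHom, hmk]
  exact (Prop121vii.liftM_coe_eq_of_unitsTransport hψ hU hπ (u : nonzeroIntegers k (AlgebraicClosure k))).symm

variable {S : ThetaSetting.{0}} [CompactSpace S.Gk]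
  (ε : S.Gk ≃ₜ* (ModelMLFGaloisData.galois (MLFClosure.std k).k (MLFClosure.std k).K).tmPair.Pi)
  (hΔ : ∀ f : S.PiX ≃ₜ* S.PiX, S.DeltaX.map f.toMulEquiv.toMonoidHom = S.DeltaX)
  (hq : Nonempty (TopGroup.quot S.PiX S.DeltaX ≃ₜ* S.Gk)) (D : TorsionReciprocityData k)

/-- **NV-L6/GalRigidityInput at the GENUINE `AbsTopMonoids`, modulo (b1) in ∃-form.** If for every topological
automorphism `φ` of `Gal(k̄/k)` SOME `φ`-equivariant units transport `ψ̄_φ : k̄ˣ ⥲ k̄ˣ` (preserving absolute units and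
uniformisers) is intertwined with `μ_{ℚ/ℤ}(φ)` by the torsion identification `D.muLift : μ_{ℚ/ℤ}(G_k) → k̄ˣ`, then
abc-iut-w4-d024's `GalRigidityInput (AbsTopMonoids.genuineOfModel S (MLFClosure.std k) ε hΔ hq)` is inhabited
((b2) by `coe_unitsTransport_unitsMap_eq_liftM`, the `Λ`-lift by `muZhatEquiv_congr_of_muLift`).
[claim: Mochizuki2012, status: disputed] (IUTchII §1 Cor 1.11, kurims p.49) -/
theorem nonempty_galRigidityInput_genuineOfModel_of_exists_muLift_natural
    (hμ : haveI := compactSpace_stdGalois k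
      ∀ φ : (ModelMLFGaloisData.galois (MLFClosure.std k).k (MLFClosure.std k).K).tmPair.Pi ≃ₜ*
          (ModelMLFGaloisData.galois (MLFClosure.std k).k (MLFClosure.std k).K).tmPair.Pi,
        ∃ ψ : (AlgebraicClosure k)ˣ ≃* (AlgebraicClosure k)ˣ,
          Prop121vii.IsAlphaEquivariant (K₁ := k) (K₂ := k) φ ψ ∧ Prop121vii.PreservesAbsUnits ψ ∧
            Prop121vii.PreservesUniformizers ψ ∧
            ∀ x : muQZ (Field.absoluteGaloisGroup k),
              Additive.toMul (D.muLift (muQZ.map φ x)) = ψ (Additive.toMul (D.muLift x))) :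
    Nonempty (GalRigidityInput (AbsTopMonoids.genuineOfModel S (MLFClosure.std k) ε hΔ hq)) := by
  haveI := compactSpace_stdGalois k
  choose ψ hψ hU hπ hnat using hμ
  exact nonempty_galRigidityInput_genuineOfModel_of_unitsTransport k ε hΔ hq D (fun φ => (ψ φ).toMonoidHom)
    (fun φ u => coe_unitsTransport_unitsMap_eq_liftM k (hψ φ) (hU φ) (hπ φ) u)
    (fun φ y => muZhatEquiv_congr_of_muLift k D φ (ψ φ).toMonoidHom (hnat φ) y)

/-- **NV-L6/GalRigidityInput at the GENUINE `AbsTopMonoids`, modulo (b1) in ∀-form.** If the torsion identification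
`D.muLift : μ_{ℚ/ℤ}(G_k) → k̄ˣ` intertwines `μ_{ℚ/ℤ}(φ)` with EVERY `φ`-equivariant uniformiser-preserving units
transport `ψ̄ : k̄ˣ ⥲ k̄ˣ` (there is exactly one for each `φ`: abc-iut-L4-d3's `Prop121vii.unitsTransport_holds`,
`unitsTransport_unique`), then `GalRigidityInput (AbsTopMonoids.genuineOfModel S (MLFClosure.std k) ε hΔ hq)` is
inhabited. [claim: Mochizuki2012, status: disputed] (IUTchII §1 Cor 1.11, kurims p.49) -/
theorem nonempty_galRigidityInput_genuineOfModel_of_muLift_natural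
    (hμ : haveI := compactSpace_stdGalois k
      ∀ (φ : (ModelMLFGaloisData.galois (MLFClosure.std k).k (MLFClosure.std k).K).tmPair.Pi ≃ₜ*
          (ModelMLFGaloisData.galois (MLFClosure.std k).k (MLFClosure.std k).K).tmPair.Pi)
        (ψ : (AlgebraicClosure k)ˣ ≃* (AlgebraicClosure k)ˣ),
        Prop121vii.IsAlphaEquivariant (K₁ := k) (K₂ := k) φ ψ → Prop121vii.PreservesUniformizers ψ →
          ∀ x : muQZ (Field.absoluteGaloisGroup k),
            Additive.toMul (D.muLift (muQZ.map φ x)) = ψ (Additive.toMul (D.muLift x))) :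
    Nonempty (GalRigidityInput (AbsTopMonoids.genuineOfModel S (MLFClosure.std k) ε hΔ hq)) := by
  haveI := compactSpace_stdGalois k
  refine nonempty_galRigidityInput_genuineOfModel_of_exists_muLift_natural k ε hΔ hq D fun φ => ?_
  obtain ⟨ψ, hψ, hU, hπ⟩ := Prop121vii.unitsTransport_holds k k φ
  exact ⟨ψ, hψ, hU, hπ, hμ φ ψ hψ hπ⟩

end AbsTopMonoids.Genuine

end Literature.IUT.HodgeArakelov

end

-- build re-enqueue 2026-08-26T07:2xZ (abc-iut-w4-d030 gen 3): STRANDED ACCEPT of p424836 (accepted 05:48:24Z inside the #15j gate reload window, no olean at 07:20Z); comment-only re-land, declarations byte-identical.
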